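import Summits.QuantumAdvantage.AdviceFreeQNC0.BlockCombDeg37
import Summits.QuantumAdvantage.AdviceFreeQNC0.RingHardOdd
import HarnessLib

/-!
# Cell qa-qnc0 — the JOIN of the two rung programmes (p1: walk-local + common gates; p2: letter-sparse + few forms), TYPED
# (planner qa-qnc0-p1 gen 37; statements, two one-line corollaries; imports the (c4⁺) file `BlockCombGates37` of ask P-37d′)

COORDINATES.  Input letters `x : Fin (n+1) → Bool` (the ring game, p2's `OddZeros x ∧ RingHLF.Rel x z`) versus walk bits
`u : Fin n → Bool` with `x = xOfU u` (`x_i` reads `u_{i-1}, u_i`; conversely `u_i` is a PREFIX PARITY of `x_0 … x_i`).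
* p2's laws ((NP₁), (NP-Γ) `RingHardSparse3`, (NP-Λ)/(NP-ΓΛ) `RingHardLinForms3`/`RingHardFourierSparse3`) are about
  outputs that are functions of `≤ log₂ n` polynomials from the span of an INSULATED-SPARSE monomial family in the LETTERS
  (dense `x`-linear forms included), with loss `n^{-e}`.
* p1's laws ((L) `WindowLocalHardU`, (G₁) `everyGateHard`, (G_r)/(G_log) `gatesHardConst`/`gatesHardLog`) are about
  outputs that read a polylog WINDOW OF WALK BITS (x-degree up to `n`, every letter pair coupled — never insulated) after
  ONE common selector of `r` dense `x`-linear gates, with CONSTANT loss `θ < 1` (the type of the crux `RingHardOdd 3`).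
The classes are incomparable; this file types their common refinement.

* (J1) `CommonGatesHard` — every output an ARBITRARY function of (the `r` COMMON gate values, its own walk window),
  `3^r (log₂ n)^{2C+2} ≤ n`, constant loss.  PROVED (`commonGatesHard`, = `gatesHardLog` with `T = 𝔽₃^r`, `f = id`).
* (J1-deg) `commonGatesHardDeg` — (J1) with «walk window» replaced by «`𝔽₂`-degree `≤ 2(log₂ n)^C` in the walk bits» (hence in
  the letters, which are affine in the walk bits): THEOREM A ⊗ (≤ log₃ n − O(log log n) common dense `MOD₃` gates).  PROVED
  (window-locality enters the comb theorem only through `hasDeg_of_windowLocal`; `blockComb_le_deg`, `gatesHardLogDeg`).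
* (J1-junta) `commonGatesJuntaHard` — output `g` = any function of the common gates and, per branch, of ANY `(log₂ n)^C` LETTERS of
  its choosing (non-local polylog fan-in).  PROVED (juntas have low `𝔽₂`-degree: `hasDeg_of_dependsOn`, `bitsOf`).
* (J1-junta-RING) `commonGatesJuntaHardRing` — (J1-junta) transported to the LETTER formulation of the crux (`OddZeros x ∧
  RingHLF.Rel x z`, as in `RingHardOdd 3`): outputs H_g(ℓ₁(x),…,ℓ_r(x), x|_{S_g}) with |S_g| ≤ (log₂ n)^C solve the relation on
  ≤ θ·2ⁿ odd-class patterns of length n+1 (𝔽₃-degree ≤ 2r + (log₂ n)^C: inside the crux's class).  PROVED.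
* (J1-deg-RING) `commonGatesDegRing` — (J1-deg) in the letter formulation: branch tables of 𝔽₂-degree ≤ 2(log₂ n)^C in the
  LETTERS (THEOREM A's letter form ⊗ common MOD₃ gates; transport `hasDeg_transport`).  PROVED.
* (J1⁺) `commonPlusLocalHard` — (J1) where output `g` reads the common gates PERTURBED by forms supported in its own window
  (`ℓ_i + λ_{g,i}`): per-output forms that agree with `≤ log₃ n − O(log log n)` common ones up to window-local corrections.  PROVED.
* (J2) `PerOutputGatesHardConst` — the same with `r` dense gates PER OUTPUT (`ℓ g i`), constant loss.  OPEN: the meeting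
  point of the two programmes and the first typed piece of the dense residual that neither engine reaches (a comb needs one
  selector blind to its good blocks — flipping a good block moves the OTHER outputs' forms; the Fourier/resonance engine
  needs insulators, which walk windows destroy, and pays `n^{-e}`).  `perOutput_imp_gatesHardConst : (J2) → (G_r)`.
* (J2⁻) `PerOutputGatesHardPoly` — (J2) with polynomial loss `1 − n^{-e}`.  OPEN; nearest to p2's (NP-Λ) (which is (J2⁻)
  WITHOUT the walk-window post-processing, over the odd class).  The obstruction to running p2's engine on (J2⁻) is its
  hypothesis (E2) `IA`: invariance under SINGLE-LETTER flips at insulators / other pairs, which in walk coordinates are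
  SUFFIX COMPLEMENTS of `u` and destroy walk-locality ((E1) `SA` does hold once the free pairs are `> 2·window` apart,
  because a pair flip `{p_j, p_j+1}` of letters is the single walk-bit flip `u_{p_j}` — `xOfU_flipN_self/succ`).
* (J3) `PerOutputFormsHardConst` — (J2) WITHOUT walk windows: every output an arbitrary function of its own `r` dense
  forms, constant loss.  OPEN; for `r = 3` (forms `e_g, e_{g+1}, α_g`: the canonical local letters plus ONE dense form) it
  contains «affine bells / (NP₁) at CONSTANT loss», the recognised gap between p2's `1 − n^{-e}` laws and the `θ`-type crux;
  `r = 1` (one dense form, no local letters) is the smallest non-local case.  `perOutputGates_imp_forms : (J2) → (J3)`.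
-/

noncomputable section

open Classical

namespace Summit.QuantumAdvantage.AdviceFreeQNC0

open Finset
open Literature.Computability.MetaComplexity Literature.Computability.MetaComplexity.Smolensky
open Literature.Computability.QuantumComplexity Literature.Computability.QuantumComplexity.RingHLF
open F4 AffBells22 Subcube

namespace BlockFibre37

variable {n : ℕ}

/-- **(J1)** every output an arbitrary function of the `r` COMMON dense gates and its own walk window; constant loss. -/
def CommonGatesHard : Prop :=
  ∃ θ : ℝ, θ < 1 ∧ ∀ C : ℕ, ∃ n₀ : ℕ, ∀ n ≥ n₀, ∀ r : ℕ, 3 ^ r * (Nat.log 2 n) ^ (2 * C + 2) ≤ n →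
    ∀ (ℓ : Fin r → Fin (n + 1) → ZMod 3) (c : ℕ) (F : Fin (n + 1) → (Fin r → ZMod 3) → (Fin n → Bool) → Bool),
    (∀ t, WindowLocal ((Nat.log 2 n) ^ C) (fun g u => F g t u)) →
    ((univ.filter fun u : Fin n → Bool =>
        ringWinU c (fun g u => F g (fun i => gateSum (ℓ i) u) u) u = true).card : ℝ) ≤ θ * (2 : ℝ) ^ n

/-- (J1) holds: `gatesHardLog` with the identity selector on `𝔽₃^r`. -/
theorem commonGatesHard : CommonGatesHard := by
  obtain ⟨θ, hθ, h⟩ := gatesHardLog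
  refine ⟨θ, hθ, fun C => ?_⟩
  obtain ⟨n₀, hC⟩ := h C
  exact ⟨n₀, fun n hn r hr ℓ c F hloc => hC n hn r hr ℓ c (Fin r → ZMod 3) id (fun t g u => F g t u) hloc⟩

/-- **(J1, DEGREE FORM)**: every output an arbitrary function of the `r` common dense `MOD₃` gates composed with tables of
`𝔽₂`-degree `≤ 2(log₂ n)^C` in the walk bits (in particular: of `𝔽₂`-degree `≤ 2(log₂ n)^C` in the letters); constant loss.
THEOREM A of the route (`AffBells22`: every low-`𝔽₂`-degree strategy) is the case of no gates. -/
theorem commonGatesHardDeg : ∃ θ : ℝ, θ < 1 ∧ ∀ C : ℕ, ∃ n₀ : ℕ, ∀ n ≥ n₀, ∀ r : ℕ, 3 ^ r * (Nat.log 2 n) ^ (2 * C + 2) ≤ n →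
    ∀ (ℓ : Fin r → Fin (n + 1) → ZMod 3) (c : ℕ) (F : Fin (n + 1) → (Fin r → ZMod 3) → (Fin n → Bool) → Bool),
    (∀ g t, HasDeg (F g t) (2 * (Nat.log 2 n) ^ C)) →
    ((univ.filter fun u : Fin n → Bool =>
        ringWinU c (fun g u => F g (fun i => gateSum (ℓ i) u) u) u = true).card : ℝ) ≤ θ * (2 : ℝ) ^ n := by
  obtain ⟨θ, hθ, h⟩ := gatesHardLogDeg
  refine ⟨θ, hθ, fun C => ?_⟩
  obtain ⟨n₀, hC⟩ := h C
  exact ⟨n₀, fun n hn r hr ℓ c F hdeg => hC n hn r hr ℓ c (Fin r → ZMod 3) id (fun t g u => F g t u) fun t g => hdeg g t⟩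

/-- a table depending on `≤ d` walk bits has `𝔽₂`-degree `≤ d`. -/
theorem hasDeg_of_dependsOn {d : ℕ} {f : (Fin n → Bool) → Bool} (W : Finset (Fin n)) (hW : W.card ≤ d)
    (hf : ∀ u v : Fin n → Bool, (∀ i ∈ W, u i = v i) → f u = f v) : HasDeg f d := by
  unfold HasDeg; exact lowDeg_mono hW (ind_mem_lowDeg_of_dependsOn (F := ZMod 2) W f hf)

/-- the walk bits read by the letters in `S` (letter `j` reads bits `j − 1` and `j`). -/
def bitsOf (S : Finset (Fin (n + 1))) : Finset (Fin n) :=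
  univ.filter fun i : Fin n =>
    (⟨i.val, Nat.lt_succ_of_lt i.isLt⟩ : Fin (n + 1)) ∈ S ∨ (⟨i.val + 1, Nat.succ_lt_succ i.isLt⟩ : Fin (n + 1)) ∈ S

/-- Membership in `bitsOf S`: walk bit `i` touches a letter position of `S` (`i` or `i+1`). -/
theorem mem_bitsOf {S : Finset (Fin (n + 1))} {i : Fin n} : i ∈ bitsOf S ↔
    (⟨i.val, Nat.lt_succ_of_lt i.isLt⟩ : Fin (n + 1)) ∈ S ∨ (⟨i.val + 1, Nat.succ_lt_succ i.isLt⟩ : Fin (n + 1)) ∈ S := by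
  unfold bitsOf; rw [mem_filter]; exact ⟨fun h => h.2, fun h => ⟨mem_univ _, h⟩⟩

/-- `#bitsOf S ≤ 2·#S`. -/
theorem card_bitsOf_le (S : Finset (Fin (n + 1))) : (bitsOf S).card ≤ 2 * S.card := by
  unfold bitsOf
  rw [filter_or, two_mul]
  refine le_trans (card_union_le _ _) (add_le_add ?_ ?_)
  · refine card_le_card_of_injOn (fun i : Fin n => (⟨i.val, Nat.lt_succ_of_lt i.isLt⟩ : Fin (n + 1))) ?_ ?_
    · intro i hi; simp only [mem_coe, mem_filter] at hi ⊢; exact hi.2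
    · intro i _ i' _ h; exact Fin.ext (Fin.mk.inj_iff.mp h)
  · refine card_le_card_of_injOn (fun i : Fin n => (⟨i.val + 1, Nat.succ_lt_succ i.isLt⟩ : Fin (n + 1))) ?_ ?_
    · intro i hi; simp only [mem_coe, mem_filter] at hi ⊢; exact hi.2
    · intro i _ i' _ h; exact Fin.ext (by have := Fin.mk.inj_iff.mp h; omega)

/-- a table depending on the letters in `S` depends on the walk bits `bitsOf S`. -/
theorem dependsOn_bitsOf {f : (Fin n → Bool) → Bool} {S : Finset (Fin (n + 1))}
    (hf : ∀ u v : Fin n → Bool, (∀ j ∈ S, xOfU u j = xOfU v j) → f u = f v) :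
    ∀ u v : Fin n → Bool, (∀ i ∈ bitsOf S, u i = v i) → f u = f v := by
  intro u v huv
  refine hf u v fun j hj => xOfU_congr j ?_ ?_
  · by_cases hjn : j.val < n
    · exact uExt_congr hjn (huv ⟨j.val, hjn⟩ (mem_bitsOf.2 (Or.inl hj)))
    · unfold uExt; rw [dif_neg hjn, dif_neg hjn]
  · by_cases hjn : j.val - 1 < n
    · refine uExt_congr hjn (huv ⟨j.val - 1, hjn⟩ (mem_bitsOf.2 ?_))
      by_cases hj0 : j.val = 0
      · left
        have e : (⟨(⟨j.val - 1, hjn⟩ : Fin n).val, Nat.lt_succ_of_lt hjn⟩ : Fin (n + 1)) = j :=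
          Fin.ext (by show j.val - 1 = j.val; omega)
        rw [e]; exact hj
      · right
        have e : (⟨(⟨j.val - 1, hjn⟩ : Fin n).val + 1, Nat.succ_lt_succ hjn⟩ : Fin (n + 1)) = j :=
          Fin.ext (by show j.val - 1 + 1 = j.val; omega)
        rw [e]; exact hj
    · unfold uExt; rw [dif_neg hjn, dif_neg hjn]

/-- **(J1-junta)**: output `g` = ANY function of the `r ≤ log₃ n − O(log log n)` common dense `MOD₃` gates and, per branch, of ANY
`(log₂ n)^C` letters of its choosing (not necessarily near `g`): constant loss.  (Non-local NC⁰-type post-processing, polylog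
fan-in, of few dense `MOD₃` gates; contains (G_log) since a walk window of radius `w` is read through `≤ 2w + 1` letters only up to
the factor 2 absorbed by `C`.) -/
theorem commonGatesJuntaHard : ∃ θ : ℝ, θ < 1 ∧ ∀ C : ℕ, ∃ n₀ : ℕ, ∀ n ≥ n₀, ∀ r : ℕ, 3 ^ r * (Nat.log 2 n) ^ (2 * C + 2) ≤ n →
    ∀ (ℓ : Fin r → Fin (n + 1) → ZMod 3) (c : ℕ) (F : Fin (n + 1) → (Fin r → ZMod 3) → (Fin n → Bool) → Bool),
    (∀ g t, ∃ S : Finset (Fin (n + 1)), S.card ≤ (Nat.log 2 n) ^ C ∧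
      ∀ u v : Fin n → Bool, (∀ j ∈ S, xOfU u j = xOfU v j) → F g t u = F g t v) →
    ((univ.filter fun u : Fin n → Bool =>
        ringWinU c (fun g u => F g (fun i => gateSum (ℓ i) u) u) u = true).card : ℝ) ≤ θ * (2 : ℝ) ^ n := by
  obtain ⟨θ, hθ, h⟩ := commonGatesHardDeg
  refine ⟨θ, hθ, fun C => ?_⟩
  obtain ⟨n₀, hC⟩ := h C
  refine ⟨n₀, fun n hn r hr ℓ c F hF => hC n hn r hr ℓ c F fun g t => ?_⟩
  obtain ⟨S, hS, hdep⟩ := hF g t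
  exact hasDeg_of_dependsOn (bitsOf S) (le_trans (card_bitsOf_le S) (by omega)) (dependsOn_bitsOf hdep)

/-- a form supported in the output's window reads only the walk window. -/
theorem gateSum_congr_of_support {ℓ' : Fin (n + 1) → ZMod 3} {g : Fin (n + 1)} {w : ℕ}
    (hsupp : ∀ j : Fin (n + 1), ℓ' j ≠ 0 → g.val + 1 ≤ j.val + w ∧ j.val < g.val + w)
    {u v : Fin n → Bool} (huv : ∀ i : Fin n, g.val ≤ i.val + w → i.val < g.val + w → u i = v i) :
    gateSum ℓ' u = gateSum ℓ' v := by
  unfold gateSum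
  refine sum_congr rfl fun j _ => ?_
  by_cases hj : ℓ' j = 0
  · simp [hj]
  · obtain ⟨h1, h2⟩ := hsupp j hj
    rw [xOfU_congr j (u := u) (u' := v) ?_ ?_]
    · by_cases hjn : j.val < n
      · exact uExt_congr hjn (huv ⟨j.val, hjn⟩ (by simp only; omega) (by simp only; omega))
      · unfold uExt; rw [dif_neg hjn, dif_neg hjn]
    · by_cases hjn : j.val - 1 < n
      · exact uExt_congr hjn (huv ⟨j.val - 1, hjn⟩ (by simp only; omega) (by simp only; omega))
      · unfold uExt; rw [dif_neg hjn, dif_neg hjn]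

/-- **(J1⁺)**: (J1) with the common gates perturbed, output by output, by forms supported in the output's own window
(`lam g i` vanishes outside the letters `j` with `g + 1 ≤ j + w`, `j < g + w`, `w = (log₂ n)^C`); constant loss. -/
theorem commonPlusLocalHard : ∃ θ : ℝ, θ < 1 ∧ ∀ C : ℕ, ∃ n₀ : ℕ, ∀ n ≥ n₀, ∀ r : ℕ, 3 ^ r * (Nat.log 2 n) ^ (2 * C + 2) ≤ n →
    ∀ (ℓ : Fin r → Fin (n + 1) → ZMod 3) (lam : Fin (n + 1) → Fin r → Fin (n + 1) → ZMod 3),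
    (∀ g i j, lam g i j ≠ 0 → g.val + 1 ≤ j.val + (Nat.log 2 n) ^ C ∧ j.val < g.val + (Nat.log 2 n) ^ C) →
    ∀ (c : ℕ) (F : Fin (n + 1) → (Fin r → ZMod 3) → (Fin n → Bool) → Bool),
    (∀ t, WindowLocal ((Nat.log 2 n) ^ C) (fun g u => F g t u)) →
    ((univ.filter fun u : Fin n → Bool =>
        ringWinU c (fun g u => F g (fun i => gateSum (ℓ i) u + gateSum (lam g i) u) u) u = true).card : ℝ)
      ≤ θ * (2 : ℝ) ^ n := by
  obtain ⟨θ, hθ, h⟩ := commonGatesHard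
  refine ⟨θ, hθ, fun C => ?_⟩
  obtain ⟨n₀, hC⟩ := h C
  refine ⟨n₀, fun n hn r hr ℓ lam hlam c F hloc => ?_⟩
  exact hC n hn r hr ℓ c (fun g t u => F g (fun i => t i + gateSum (lam g i) u) u) fun t g u v huv => by
    show F g (fun i => t i + gateSum (lam g i) u) u = F g (fun i => t i + gateSum (lam g i) v) v
    have e : (fun i => t i + gateSum (lam g i) u) = (fun i => t i + gateSum (lam g i) v) :=
      funext fun i => by rw [gateSum_congr_of_support (hlam g i) huv]
    rw [e]; exact hloc _ g u v huv

/-- **(J1-junta) IN THE LETTER FORMULATION OF THE CRUX** (`OddZeros x ∧ RingHLF.Rel x z`, patterns of length `n + 1`, as in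
`RingHardOdd 3`): every ring strategy whose output `g` is an arbitrary function of `r` COMMON dense `𝔽₃`-linear forms of the pattern
and of any `(log₂ n)^C` letters of its own choosing (`3^r·(log₂ n)^{2C+4} ≤ n`) solves the relation on at most `θ·2ⁿ` odd-class
patterns.  Such outputs have `𝔽₃`-degree `≤ 2r + (log₂ n)^C`: a sub-case of the crux's class with DENSE `𝔽₃` structure.  Transport =
WalkTransport (`rel_iff_ringWinU`, `xOfU_uVec`): the canonical guess `tGuess` reads two more letters, `xOfU (uVec x) = x` on the odd class. -/
theorem commonGatesJuntaHardRing : ∃ θ : ℝ, θ < 1 ∧ ∀ C : ℕ, ∃ n₀ : ℕ, ∀ n ≥ n₀, ∀ r : ℕ,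
    3 ^ r * (Nat.log 2 n) ^ (2 * C + 4) ≤ n →
    ∀ (ℓ : Fin r → Fin (n + 1) → ZMod 3) (H : Fin (n + 1) → (Fin r → ZMod 3) → (Fin (n + 1) → Bool) → Bool),
    (∀ g t, ∃ S : Finset (Fin (n + 1)), S.card ≤ (Nat.log 2 n) ^ C ∧
      ∀ x x' : Fin (n + 1) → Bool, (∀ j ∈ S, x j = x' j) → H g t x = H g t x') →
    ((univ.filter fun x : Fin (n + 1) → Bool => OddZeros x ∧
        RingHLF.Rel x (fun g => H g (fun i => ∑ j : Fin (n + 1), if x j = true then ℓ i j else 0) x)).card : ℝ)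
      ≤ θ * (2 : ℝ) ^ n := by
  obtain ⟨θ, hθ, h⟩ := commonGatesJuntaHard
  refine ⟨θ, hθ, fun C => ?_⟩
  obtain ⟨n₀, hC⟩ := h (C + 1)
  refine ⟨max n₀ 8, fun n hn r hr ℓ H hH => ?_⟩
  have hn₀ : n₀ ≤ n := le_trans (le_max_left _ _) hn
  have hn8 : 8 ≤ n := le_trans (le_max_right _ _) hn
  have hL : 3 ≤ Nat.log 2 n := Nat.le_log_of_pow_le (by norm_num) (by norm_num; omega)
  -- the transported walk strategy, branch tables indexed by the gate values
  set F : Fin (n + 1) → (Fin r → ZMod 3) → (Fin n → Bool) → Bool :=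
    fun g t u => xor (H g t (xOfU u)) (tGuess (xOfU u) g) with hF
  have hr' : 3 ^ r * (Nat.log 2 n) ^ (2 * (C + 1) + 2) ≤ n := by
    rw [show 2 * (C + 1) + 2 = 2 * C + 4 by ring]; exact hr
  have hjunta : ∀ g t, ∃ S : Finset (Fin (n + 1)), S.card ≤ (Nat.log 2 n) ^ (C + 1) ∧
      ∀ u v : Fin n → Bool, (∀ j ∈ S, xOfU u j = xOfU v j) → F g t u = F g t v := by
    intro g t
    obtain ⟨S, hS, hdep⟩ := hH g t
    refine ⟨S ∪ {g, nxt g}, ?_, fun u v huv => ?_⟩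
    · have h1 : (S ∪ {g, nxt g}).card ≤ S.card + 2 :=
        le_trans (card_union_le _ _) (Nat.add_le_add_left Finset.card_le_two _)
      have h2 : (Nat.log 2 n) ^ C + 2 ≤ (Nat.log 2 n) ^ (C + 1) := by
        rw [pow_succ]
        have : 1 ≤ (Nat.log 2 n) ^ C := Nat.one_le_pow _ _ (by omega)
        nlinarith
      omega
    · show xor (H g t (xOfU u)) (tGuess (xOfU u) g) = xor (H g t (xOfU v)) (tGuess (xOfU v) g)
      have hH' : H g t (xOfU u) = H g t (xOfU v) :=
        hdep _ _ fun j hj => huv j (mem_union_left _ hj)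
      have hg : xOfU u g = xOfU v g := huv g (mem_union_right _ (by simp))
      have hg' : xOfU u (nxt g) = xOfU v (nxt g) := huv (nxt g) (mem_union_right _ (by simp))
      rw [hH']; unfold tGuess; rw [hg, hg']
  have hwin := hC n hn₀ r hr' ℓ (n + 2) F hjunta
  -- odd-class solved patterns inject (by `uVec`) into winning walk points
  have hodd : (univ.filter fun x : Fin (n + 1) → Bool => OddZeros x ∧
        RingHLF.Rel x (fun g => H g (fun i => ∑ j : Fin (n + 1), if x j = true then ℓ i j else 0) x)).card ≤
      (univ.filter fun u : Fin n → Bool =>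
        ringWinU (n + 2) (fun g u => F g (fun i => gateSum (ℓ i) u) u) u = true).card := by
    refine Finset.card_le_card_of_injOn uVec ?_ ?_
    · intro x hx
      simp only [Finset.mem_coe, mem_filter] at hx ⊢
      refine ⟨mem_univ _, ?_⟩
      exact (rel_iff_ringWinU (by omega) x hx.2.1
        (fun x g => H g (fun i => ∑ j : Fin (n + 1), if x j = true then ℓ i j else 0) x)).1 hx.2.2
    · intro x₁ hx₁ x₂ hx₂ h
      simp only [Finset.mem_coe, mem_filter] at hx₁ hx₂
      rw [← xOfU_uVec (by omega) x₁ hx₁.2.1, ← xOfU_uVec (by omega) x₂ hx₂.2.1, h]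
  exact le_trans (by exact_mod_cast hodd) hwin

/-- **(J1-deg) IN THE LETTER FORMULATION OF THE CRUX**: every ring strategy whose output `g` is an arbitrary function of `r`
COMMON dense `𝔽₃`-linear forms of the pattern composed with branch tables of `𝔽₂`-DEGREE `≤ 2(log₂ n)^C` in the letters solves the
relation on at most `θ·2ⁿ` odd-class patterns (`3^r·(log₂ n)^{2C+2} ≤ n`).  THEOREM A of the route, in its letter form, is the case
of no gates; this is the mixed-moduli class «low-`𝔽₂`-degree post-processing of few common `MOD₃` gates».  Transport: `hasDeg_transport`
(the letters are affine in the walk bits), `rel_iff_ringWinU`, `xOfU_uVec`. -/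
theorem commonGatesDegRing : ∃ θ : ℝ, θ < 1 ∧ ∀ C : ℕ, ∃ n₀ : ℕ, ∀ n ≥ n₀, ∀ r : ℕ,
    3 ^ r * (Nat.log 2 n) ^ (2 * C + 2) ≤ n →
    ∀ (ℓ : Fin r → Fin (n + 1) → ZMod 3) (H : Fin (n + 1) → (Fin r → ZMod 3) → (Fin (n + 1) → Bool) → Bool),
    (∀ g t, (fun x => if H g t x = true then (1 : ZMod 2) else 0) ∈ lowDeg (ZMod 2) (n + 1) (2 * (Nat.log 2 n) ^ C)) →
    ((univ.filter fun x : Fin (n + 1) → Bool => OddZeros x ∧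
        RingHLF.Rel x (fun g => H g (fun i => ∑ j : Fin (n + 1), if x j = true then ℓ i j else 0) x)).card : ℝ)
      ≤ θ * (2 : ℝ) ^ n := by
  obtain ⟨θ, hθ, h⟩ := commonGatesHardDeg
  refine ⟨θ, hθ, fun C => ?_⟩
  obtain ⟨n₀, hC⟩ := h C
  refine ⟨max n₀ 2, fun n hn r hr ℓ H hH => ?_⟩
  have hn₀ : n₀ ≤ n := le_trans (le_max_left _ _) hn
  have hn2 : 2 ≤ n := le_trans (le_max_right _ _) hn
  have hL : 1 ≤ Nat.log 2 n := Nat.le_log_of_pow_le (by norm_num) (by norm_num; omega)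
  set F : Fin (n + 1) → (Fin r → ZMod 3) → (Fin n → Bool) → Bool :=
    fun g t u => xor (H g t (xOfU u)) (tGuess (xOfU u) g) with hF
  have hdeg : ∀ g t, HasDeg (F g t) (2 * (Nat.log 2 n) ^ C) := by
    intro g t
    have hD : 1 ≤ 2 * (Nat.log 2 n) ^ C := le_trans (Nat.one_le_pow _ _ hL) (Nat.le_mul_of_pos_left _ (by norm_num))
    have key := hasDeg_transport hD (fun x => if H g t x = true then (1 : ZMod 2) else 0) (hH g t) g
    have e : (fun u : Fin n → Bool =>
        xor (decide ((fun x => if H g t x = true then (1 : ZMod 2) else 0) (xOfU u) = 1)) (tGuess (xOfU u) g)) = F g t := by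
      funext u
      show xor (decide ((if H g t (xOfU u) = true then (1 : ZMod 2) else 0) = 1)) (tGuess (xOfU u) g) =
        xor (H g t (xOfU u)) (tGuess (xOfU u) g)
      cases H g t (xOfU u) <;> cases tGuess (xOfU u) g <;> decide
    rw [e] at key; exact key
  have hwin := hC n hn₀ r hr ℓ (n + 2) F hdeg
  have hodd : (univ.filter fun x : Fin (n + 1) → Bool => OddZeros x ∧
        RingHLF.Rel x (fun g => H g (fun i => ∑ j : Fin (n + 1), if x j = true then ℓ i j else 0) x)).card ≤
      (univ.filter fun u : Fin n → Bool =>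
        ringWinU (n + 2) (fun g u => F g (fun i => gateSum (ℓ i) u) u) u = true).card := by
    refine Finset.card_le_card_of_injOn uVec ?_ ?_
    · intro x hx
      simp only [Finset.mem_coe, mem_filter] at hx ⊢
      refine ⟨mem_univ _, ?_⟩
      exact (rel_iff_ringWinU (by omega) x hx.2.1
        (fun x g => H g (fun i => ∑ j : Fin (n + 1), if x j = true then ℓ i j else 0) x)).1 hx.2.2
    · intro x₁ hx₁ x₂ hx₂ h'
      simp only [Finset.mem_coe, mem_filter] at hx₁ hx₂
      rw [← xOfU_uVec (by omega) x₁ hx₁.2.1, ← xOfU_uVec (by omega) x₂ hx₂.2.1, h']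
  exact le_trans (by exact_mod_cast hodd) hwin

/-- **(J2)** (OPEN — the meeting point): `r` dense gates PER OUTPUT, walk-local post-processing, constant loss. -/
def PerOutputGatesHardConst : Prop :=
  ∃ θ : ℝ, θ < 1 ∧ ∀ r C : ℕ, ∃ n₀ : ℕ, ∀ n ≥ n₀,
    ∀ (ℓ : Fin (n + 1) → Fin r → Fin (n + 1) → ZMod 3) (c : ℕ) (F : Fin (n + 1) → (Fin r → ZMod 3) → (Fin n → Bool) → Bool),
    (∀ t, WindowLocal ((Nat.log 2 n) ^ C) (fun g u => F g t u)) →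
    ((univ.filter fun u : Fin n → Bool =>
        ringWinU c (fun g u => F g (fun i => gateSum (ℓ g i) u) u) u = true).card : ℝ) ≤ θ * (2 : ℝ) ^ n

/-- **(J2⁻)** (OPEN): (J2) with polynomial loss. -/
def PerOutputGatesHardPoly : Prop :=
  ∃ e : ℕ, ∀ r C : ℕ, ∃ n₀ : ℕ, ∀ n ≥ n₀,
    ∀ (ℓ : Fin (n + 1) → Fin r → Fin (n + 1) → ZMod 3) (c : ℕ) (F : Fin (n + 1) → (Fin r → ZMod 3) → (Fin n → Bool) → Bool),
    (∀ t, WindowLocal ((Nat.log 2 n) ^ C) (fun g u => F g t u)) →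
    ((univ.filter fun u : Fin n → Bool =>
        ringWinU c (fun g u => F g (fun i => gateSum (ℓ g i) u) u) u = true).card : ℝ) ≤ (1 - 1 / (n : ℝ) ^ e) * (2 : ℝ) ^ n

/-- **(J3)** (OPEN): every output an arbitrary function of its own `r` dense forms, no walk window; constant loss
(`r = 3` with `ℓ g 0 = e_g`, `ℓ g 1 = e_{g+1}` contains the affine-bell class at constant loss). -/
def PerOutputFormsHardConst : Prop :=
  ∃ θ : ℝ, θ < 1 ∧ ∀ r : ℕ, ∃ n₀ : ℕ, ∀ n ≥ n₀,
    ∀ (ℓ : Fin (n + 1) → Fin r → Fin (n + 1) → ZMod 3) (c : ℕ) (F : Fin (n + 1) → (Fin r → ZMod 3) → Bool),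
    ((univ.filter fun u : Fin n → Bool =>
        ringWinU c (fun g u => F g (fun i => gateSum (ℓ g i) u)) u = true).card : ℝ) ≤ θ * (2 : ℝ) ^ n

/-- sanity: (J2) contains (J3) (a window-free table is window-local for every window). -/
theorem perOutputGates_imp_forms (h : PerOutputGatesHardConst) : PerOutputFormsHardConst := by
  obtain ⟨θ, hθ, hmain⟩ := h
  refine ⟨θ, hθ, fun r => ?_⟩
  obtain ⟨n₀, hC⟩ := hmain r 0
  exact ⟨n₀, fun n hn ℓ c F => hC n hn ℓ c (fun g t _ => F g t) fun t g u v _ => rfl⟩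

/-- sanity: (J2) contains (G_r) (take the same gates for every output). -/
theorem perOutput_imp_gatesHardConst (h : PerOutputGatesHardConst) : GatesHardConst := by
  obtain ⟨θ, hθ, hmain⟩ := h
  refine ⟨θ, hθ, fun k C => ?_⟩
  obtain ⟨n₀, hC⟩ := hmain k C
  exact ⟨n₀, fun n hn ℓ c T f G hloc => hC n hn (fun _ i => ℓ i) c (fun g t u => G (f t) g u) fun t => hloc (f t)⟩

/-- sanity: (J2) implies (J2⁻) (any `e ≥ 1` once `θ ≤ 1 − n^{-1}`, i.e. `n ≥ 1/(1−θ)`). -/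
theorem perOutput_poly_of_const (h : PerOutputGatesHardConst) : PerOutputGatesHardPoly := by
  obtain ⟨θ, hθ, hmain⟩ := h
  obtain ⟨N, hN⟩ := exists_nat_gt (1 / (1 - θ))
  refine ⟨1, fun r C => ?_⟩
  obtain ⟨n₀, hC⟩ := hmain r C
  refine ⟨max n₀ (max N 1), fun n hn ℓ c F hloc => le_trans (hC n (le_trans (le_max_left _ _) hn) ℓ c F hloc) ?_⟩
  have hn1 : (N : ℝ) ≤ n := by exact_mod_cast le_trans (le_trans (le_max_left _ _) (le_max_right _ _)) hn
  have hn2 : (1 : ℝ) ≤ n := by exact_mod_cast le_trans (le_trans (le_max_right _ _) (le_max_right _ _)) hn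
  have h1 : 0 < 1 - θ := by linarith
  have h2 : 1 / (1 - θ) < n := lt_of_lt_of_le hN hn1
  have h3 : 1 < n * (1 - θ) := by rw [div_lt_iff₀ h1] at h2; linarith
  have h4 : θ ≤ 1 - 1 / (n : ℝ) ^ 1 := by
    have h5 : 1 / (n : ℝ) ≤ 1 - θ := by rw [div_le_iff₀ (by linarith)]; nlinarith
    rw [pow_one]; linarith
  exact mul_le_mul_of_nonneg_right h4 (by positivity)

end BlockFibre37

end Summit.QuantumAdvantage.AdviceFreeQNC0
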